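/-
Copyright: b2b-lace packet (LEAN typing seat 1, gen 33).  T-CS-M: the ONE-FACTOR Cauchy–Schwarz bound of
`T_{n,l}(x)` keeping `|D̂^{(x)}|` exact — `T_{n,l₁+l₂}(x)² ≤ K_{n,2l₁}(x) · KM₂_{n,2l₂}(x)` with the `M̂²`-insertion
`KM₂_{n,l}(x) = ∫ |D̂|^l |D̂^{(x)}| M̂² Ĉⁿ`.  d-generic; no numeral table; no `sorry`.
-/
import Literature.Probability.FitznerVanDerHofstad2017.SrwIntegralTPairing
import Literature.Probability.FitznerVanDerHofstad2017.SrwIntegralB3Transport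
import HarnessLib

/-!
# One-factor Cauchy–Schwarz for `T_{n,l}(x)`: `T_{n,l₁+l₂}(x) ≤ √K_{n,2l₁}(x) · √KM₂_{n,2l₂}(x)`

CITATION HEADER (PLACEMENT v2). This module is part of a certified REPRODUCTION of:
R. Fitzner, R. van der Hofstad, *Mean-field behavior for nearest-neighbor percolation in d > 10*,
Electron. J. Probab. 22 (2017), no. 43 [FvdH17], and *Generalized approach to the non-backtracking lace
expansion*, Probab. Theory Related Fields 169 (2017) 1041–1119 [NoBLE17-I] (arXiv:1506.07977, 1506.07969).
Reproduces: the Cauchy–Schwarz DEVICE of [NoBLE17-I] §5.2 (5.9)/(5.11) p. 1091–1092 for the SRW input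
`T_{n,l}(x) = ∫ |D̂|^l Ĉⁿ |D̂^{(x)}| |M̂|` ((3.37) p. 1071), in the ONE-FACTOR form that keeps the factor `|D̂^{(x)}(k)|`
in BOTH Cauchy–Schwarz partners (the Schwarz-inequality device of [NoBLE17-I] §5.2, going back to T. Hara, G. Slade,
Rev. Math. Phys. 4 (1992), App. B).  Origin: build `lace`, node KU-CF (carver-g42, `HOME/carver/g42/kuja/KU-CF-SPEC.md` §0/§5
"T-CS-M"), leaf T-CS-M, typing seat 1 (lean1-g33); companion of `SrwIntegralTPairing` (`srwT_le_sqrt_srwM2_mul_srwW`,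
the two-factor pairing with the `|D̂^{(x)}|`-FREE second moment `M₂`).

## What is here (all `d`-generic)

* `srwKM2 d n l x` — `KM₂_{n,l}(x) = ∫_{[-π,π]^d} |D̂(k)|^l |D̂^{(x)}(k)| M̂(k)² Ĉ(k)ⁿ dk/(2π)^d`, the `M̂²`-insertion of
  `K_{n,l}(x)` ((3.36)); `srwKM2_nonneg`; `integrable_srwKM2_integrand` (`d ≥ 2n+1`: bounded weight, `M̂² ≤ 25`);
  `srwKM2_spAct` (`W_d`-invariance — so the region split `SrwRegionSplitAxis.le_of_axis_or_multi` applies to it);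
  `srwKM2_anti` (monotone non-increasing in `l`);
* `srwT_integrand_le_oneFactor` — pointwise AM–GM behind the bound;
* `srwT_le_sqrt_srwK_mul_srwKM2` — **`T_{n,l₁+l₂}(x) ≤ √K_{n,2l₁}(x) · √KM₂_{n,2l₂}(x)`** (`d ≥ 2n+1`), i.e.
  Cauchy–Schwarz on `(|D̂|^{l₁} √(|D̂^{(x)}| Ĉⁿ)) · (|D̂|^{l₂} |M̂| √(|D̂^{(x)}| Ĉⁿ))`.  Instances the KU-CF device reads:
  `T_{n,0} ≤ √(K_{n,0} KM₂_{n,0})` (`l₁ = l₂ = 0`), `T_{n,1} ≤ min(√(K_{n,0} KM₂_{n,2}), √(K_{n,2} KM₂_{n,0}))`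
  (`(0,1)`, `(1,0)`: `srwT_one_le_min`), `T_{n,2} ≤ √(K_{n,2} KM₂_{n,2})` (`(1,1)`), …;
  table-ready `srwT_le_sqrt_of_srwK_le_of_srwKM2_le` (`K ≤ a`, `KM₂ ≤ b` ⟹ `T ≤ √(ab)`).

## What is NOT here
No dimension, no table, no value of any `KM₂` (those are functionals of the KU-CF engine device, leaf KU-CF-ENCL — not a
kernel object today); nothing of record (CERT REV 14, `d = 11`) and no `d = 10` module is touched; no `…Of`/`…At`
instance.  The inequality is exact bookkeeping: it loses only the one Cauchy–Schwarz step.  Note: bounding `KM₂_{n,2l₂}(x) ≤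
M₂_{n,l₂}` by `|D̂^{(x)}| ≤ 1` would only reproduce a bound WEAKER than `srwT_le_sqrt_srwM2_mul_srwW` (since
`(D̂^{(x)})² ≤ |D̂^{(x)}|`), so no such corollary is stated — the gain of the one-factor form lies entirely in certified
values of `KM₂` itself.
-/

open MeasureTheory Real Finset
open scoped BigOperators

namespace Literature.Probability.FitznerVanDerHofstad2017

open Literature.Barriers.CriticalPhenomena
open Literature.Barriers.CriticalPhenomena.Slade2006Prop53 (P)

variable {d : ℕ}

/-! ### The `M̂²`-insertion `KM₂_{n,l}(x)` of `K_{n,l}(x)` -/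

/-- `KM₂_{n,l}(x) = ∫_{[-π,π]^d} |D̂(k)|^l |D̂^{(x)}(k)| M̂(k)² Ĉ(k)ⁿ dk/(2π)^d` — the one-factor Cauchy–Schwarz partner of
`K_{n,l}(x)` for `T`.  Not an object of the source; notation after (3.36)–(3.37). [folklore] -/
noncomputable def srwKM2 (d n l : ℕ) (x : Fin d → ℤ) : ℝ :=
  (∫ k, (|Dhat d k| ^ l * |DhatSym d x k| * Mhat d k ^ 2) * Chat d 1 k ^ n ∂P d) / (2 * π) ^ d

/-- `KM₂_{n,l}(x) ≥ 0`. [cite: FitznerVanDerHofstad2016NoBLE, (3.36)–(3.37) p. 1071] -/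
theorem srwKM2_nonneg (n l : ℕ) (x : Fin d → ℤ) : 0 ≤ srwKM2 d n l x :=
  div_nonneg (integral_nonneg fun k => mul_nonneg
    (mul_nonneg (mul_nonneg (pow_nonneg (abs_nonneg _) l) (abs_nonneg _)) (sq_nonneg _))
    (pow_nonneg (Chat_one_nonneg k) n)) (two_pi_pow_pos d).le

/-- The `KM₂`-integrand is integrable for `d ≥ 2n + 1` (bounded weight `|D̂|^l |D̂^{(x)}| M̂² ≤ 25` times `Ĉⁿ`,
[HvdH17] Prop. 5.5 via `integrable_weight_mul_Chat_pow`). [cite: HeydenreichVanDerHofstad2017, Prop. 5.5] -/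
theorem integrable_srwKM2_integrand {n : ℕ} (hd : 2 * n + 1 ≤ d) (l : ℕ) (x : Fin d → ℤ) :
    Integrable (fun k => (|Dhat d k| ^ l * |DhatSym d x k| * Mhat d k ^ 2) * Chat d 1 k ^ n) (P d) := by
  have hd1 : 1 ≤ d := by omega
  have h := integrable_weight_mul_Chat_pow hd (w := fun k => (|Dhat d k| ^ l * |DhatSym d x k| * Mhat d k ^ 2) / 25)
    (((((continuous_Dhat d).measurable.abs.pow_const l).mul (measurable_DhatSym d x).abs).mul
      ((measurable_Mhat d).pow_const 2)).div_const 25)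
    fun k => by
      rw [abs_div, abs_mul, abs_mul, abs_pow, abs_abs, abs_abs, abs_pow,
        abs_of_pos (by norm_num : (0 : ℝ) < 25), div_le_one (by norm_num)]
      have hM : |Mhat d k| ^ 2 ≤ 5 ^ 2 := pow_le_pow_left₀ (abs_nonneg _) (abs_Mhat_le_five hd1 k) 2
      have hD : |Dhat d k| ^ l ≤ 1 := abs_Dhat_pow_le_one l k
      have hS : |DhatSym d x k| ≤ 1 := abs_DhatSym_le_one x k
      have h1 : |Dhat d k| ^ l * |DhatSym d x k| ≤ 1 :=
        (mul_le_mul hD hS (abs_nonneg _) zero_le_one).trans_eq (one_mul 1)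
      nlinarith [mul_nonneg (pow_nonneg (abs_nonneg (Dhat d k)) l) (abs_nonneg (DhatSym d x k)),
        pow_nonneg (abs_nonneg (Mhat d k)) 2]
  refine (h.const_mul 25).congr (ae_of_all _ fun k => ?_)
  simp only
  ring

/-- `KM₂_{n,l}(σ x) = KM₂_{n,l}(x)` for every signed permutation `σ` (`W_d`-invariance, from `DhatSym_spAct`).
[cite: FitznerVanDerHofstad2016NoBLE, (3.34), (3.36) p. 1071] -/
theorem srwKM2_spAct (n l : ℕ) (τ : SgnPermPair d) (x : Fin d → ℤ) :
    srwKM2 d n l (spAct τ x) = srwKM2 d n l x := by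
  unfold srwKM2
  simp_rw [DhatSym_spAct]

/-- Monotonisation in `l`: `KM₂_{n,l'}(x) ≤ KM₂_{n,l}(x)` for `l ≤ l'` (`|D̂| ≤ 1`; `d ≥ 2n+1`).
[cite: FitznerVanDerHofstad2016NoBLE, (3.36) p. 1071; (5.10) p. 1092] -/
theorem srwKM2_anti {n : ℕ} (hd : 2 * n + 1 ≤ d) (x : Fin d → ℤ) {l l' : ℕ} (h : l ≤ l') :
    srwKM2 d n l' x ≤ srwKM2 d n l x := by
  unfold srwKM2
  refine div_le_div_of_nonneg_right ?_ (two_pi_pow_pos d).le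
  refine integral_mono_of_nonneg (ae_of_all _ fun k => ?_) (integrable_srwKM2_integrand hd l x)
    (ae_of_all _ fun k => ?_)
  · exact mul_nonneg (mul_nonneg (mul_nonneg (pow_nonneg (abs_nonneg _) l') (abs_nonneg _)) (sq_nonneg _))
      (pow_nonneg (Chat_one_nonneg k) n)
  · have h1 : |Dhat d k| ^ l' ≤ |Dhat d k| ^ l :=
      pow_le_pow_of_le_one (abs_nonneg _) (abs_Dhat_le_one k) h
    exact mul_le_mul_of_nonneg_right (mul_le_mul_of_nonneg_right
      (mul_le_mul_of_nonneg_right h1 (abs_nonneg _)) (sq_nonneg _)) (pow_nonneg (Chat_one_nonneg k) n)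

/-! ### The one-factor Cauchy–Schwarz bound -/

/-- Pointwise AM–GM behind the one-factor bound: for `λ > 0`,
`|D̂|^{l₁+l₂} |D̂^{(x)}| |M̂| Ĉⁿ ≤ (λ · |D̂|^{2l₁} |D̂^{(x)}| Ĉⁿ + λ⁻¹ · |D̂|^{2l₂} |D̂^{(x)}| M̂² Ĉⁿ) / 2`
(AM–GM on `a = |D̂|^{l₁} √(|D̂^{(x)}| Ĉⁿ)`, `b = |D̂|^{l₂} |M̂| √(|D̂^{(x)}| Ĉⁿ)`).
[cite: FitznerVanDerHofstad2016NoBLE, §5.2 (5.9) p. 1091] -/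
theorem srwT_integrand_le_oneFactor (n l₁ l₂ : ℕ) (x : Fin d → ℤ) (k : Fin d → ℝ) {lam : ℝ} (hl : 0 < lam) :
    (|Dhat d k| ^ (l₁ + l₂) * |DhatSym d x k| * |Mhat d k|) * Chat d 1 k ^ n ≤
      (lam * ((|Dhat d k| ^ (2 * l₁) * |DhatSym d x k|) * Chat d 1 k ^ n) +
        ((|Dhat d k| ^ (2 * l₂) * |DhatSym d x k| * Mhat d k ^ 2) * Chat d 1 k ^ n) / lam) / 2 := by
  have hC : 0 ≤ Chat d 1 k ^ n := pow_nonneg (Chat_one_nonneg k) n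
  have hS : 0 ≤ |DhatSym d x k| * Chat d 1 k ^ n := mul_nonneg (abs_nonneg _) hC
  set s := Real.sqrt (|DhatSym d x k| * Chat d 1 k ^ n) with hs
  have hs2 : s ^ 2 = |DhatSym d x k| * Chat d 1 k ^ n := by rw [hs, Real.sq_sqrt hS]
  have hs0 : 0 ≤ s := Real.sqrt_nonneg _
  have h := abs_mul_abs_le_am_gm (|Dhat d k| ^ l₁ * s) (|Dhat d k| ^ l₂ * Mhat d k * s) hl
  have e1 : |(|Dhat d k| ^ l₁ * s)| * |(|Dhat d k| ^ l₂ * Mhat d k * s)| =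
      (|Dhat d k| ^ (l₁ + l₂) * |DhatSym d x k| * |Mhat d k|) * Chat d 1 k ^ n := by
    rw [abs_mul, abs_mul, abs_mul, abs_pow, abs_pow, abs_abs, abs_of_nonneg hs0,
      show |Dhat d k| ^ l₁ * s * (|Dhat d k| ^ l₂ * |Mhat d k| * s)
        = |Dhat d k| ^ l₁ * |Dhat d k| ^ l₂ * |Mhat d k| * s ^ 2 by ring, hs2, pow_add]
    ring
  have e2 : lam * (|Dhat d k| ^ l₁ * s) ^ 2 + (|Dhat d k| ^ l₂ * Mhat d k * s) ^ 2 / lam =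
      lam * ((|Dhat d k| ^ (2 * l₁) * |DhatSym d x k|) * Chat d 1 k ^ n) +
        ((|Dhat d k| ^ (2 * l₂) * |DhatSym d x k| * Mhat d k ^ 2) * Chat d 1 k ^ n) / lam := by
    rw [show (|Dhat d k| ^ l₁ * s) ^ 2 = (|Dhat d k| ^ l₁) ^ 2 * s ^ 2 by ring,
      show (|Dhat d k| ^ l₂ * Mhat d k * s) ^ 2 = (|Dhat d k| ^ l₂) ^ 2 * Mhat d k ^ 2 * s ^ 2 by ring,
      hs2, ← pow_mul, ← pow_mul, mul_comm l₁ 2, mul_comm l₂ 2]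
    ring
  rw [e1, e2] at h
  exact h

/-- **One-factor Cauchy–Schwarz for `T`** (`d ≥ 2n+1`): `T_{n,l₁+l₂}(x) ≤ √K_{n,2l₁}(x) · √KM₂_{n,2l₂}(x)` —
Cauchy–Schwarz with the split `(|D̂|^{l₁} √(|D̂^{(x)}| Ĉⁿ)) · (|D̂|^{l₂} |M̂| √(|D̂^{(x)}| Ĉⁿ))`, keeping `|D̂^{(x)}|`
in both factors (contrast `srwT_le_sqrt_srwM2_mul_srwW`, which puts `(D̂^{(x)})²` in one factor only).
[cite: FitznerVanDerHofstad2016NoBLE, §5.2 (5.9), (5.11) p. 1091–1092] -/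
theorem srwT_le_sqrt_srwK_mul_srwKM2 {n : ℕ} (hd : 2 * n + 1 ≤ d) (l₁ l₂ : ℕ) (x : Fin d → ℤ) :
    srwT d n (l₁ + l₂) x ≤ Real.sqrt (srwK d n (2 * l₁) x) * Real.sqrt (srwKM2 d n (2 * l₂) x) := by
  refine le_sqrt_mul_sqrt_of_forall (srwK_nonneg n (2 * l₁) x) (srwKM2_nonneg n (2 * l₂) x) fun lam hl => ?_
  have hA := integrable_srwK_integrand hd (2 * l₁) x
  have hB := integrable_srwKM2_integrand hd (2 * l₂) x
  have key : ∫ k, (|Dhat d k| ^ (l₁ + l₂) * |DhatSym d x k| * |Mhat d k|) * Chat d 1 k ^ n ∂P d ≤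
      ∫ k, (lam * ((|Dhat d k| ^ (2 * l₁) * |DhatSym d x k|) * Chat d 1 k ^ n) +
        ((|Dhat d k| ^ (2 * l₂) * |DhatSym d x k| * Mhat d k ^ 2) * Chat d 1 k ^ n) / lam) / 2 ∂P d := by
    refine integral_mono_of_nonneg (ae_of_all _ fun k => ?_)
      (((hA.const_mul lam).add (hB.div_const lam)).div_const 2)
      (ae_of_all _ fun k => srwT_integrand_le_oneFactor n l₁ l₂ x k hl)
    exact mul_nonneg (mul_nonneg (mul_nonneg (pow_nonneg (abs_nonneg _) _) (abs_nonneg _)) (abs_nonneg _))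
      (pow_nonneg (Chat_one_nonneg k) _)
  have e : ∫ k, (lam * ((|Dhat d k| ^ (2 * l₁) * |DhatSym d x k|) * Chat d 1 k ^ n) +
        ((|Dhat d k| ^ (2 * l₂) * |DhatSym d x k| * Mhat d k ^ 2) * Chat d 1 k ^ n) / lam) / 2 ∂P d =
      (lam * (∫ k, (|Dhat d k| ^ (2 * l₁) * |DhatSym d x k|) * Chat d 1 k ^ n ∂P d) +
        (∫ k, (|Dhat d k| ^ (2 * l₂) * |DhatSym d x k| * Mhat d k ^ 2) * Chat d 1 k ^ n ∂P d) / lam) / 2 := by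
    rw [integral_div, integral_add (hA.const_mul lam) (hB.div_const lam), integral_const_mul, integral_div]
  unfold srwT srwK srwKM2
  calc (∫ k, (|Dhat d k| ^ (l₁ + l₂) * |DhatSym d x k| * |Mhat d k|) * Chat d 1 k ^ n ∂P d) / (2 * π) ^ d
      ≤ ((lam * (∫ k, (|Dhat d k| ^ (2 * l₁) * |DhatSym d x k|) * Chat d 1 k ^ n ∂P d) +
          (∫ k, (|Dhat d k| ^ (2 * l₂) * |DhatSym d x k| * Mhat d k ^ 2) * Chat d 1 k ^ n ∂P d) / lam) / 2)
          / (2 * π) ^ d :=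
        div_le_div_of_nonneg_right (key.trans_eq e) (two_pi_pow_pos d).le
    _ = _ := by ring

/-- Table-ready form: `K_{n,2l₁}(x) ≤ a` and `KM₂_{n,2l₂}(x) ≤ b` give `T_{n,l₁+l₂}(x) ≤ √(a·b)` (`d ≥ 2n+1`).
[cite: FitznerVanDerHofstad2016NoBLE, §5.2 (5.9), (5.11) p. 1091–1092] -/
theorem srwT_le_sqrt_of_srwK_le_of_srwKM2_le {n : ℕ} (hd : 2 * n + 1 ≤ d) {l₁ l₂ : ℕ} {x : Fin d → ℤ}
    {a b : ℝ} (ha : srwK d n (2 * l₁) x ≤ a) (hb : srwKM2 d n (2 * l₂) x ≤ b) :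
    srwT d n (l₁ + l₂) x ≤ Real.sqrt (a * b) := by
  have hK := srwK_nonneg n (2 * l₁) x
  have hM := srwKM2_nonneg n (2 * l₂) x
  calc srwT d n (l₁ + l₂) x ≤ Real.sqrt (srwK d n (2 * l₁) x) * Real.sqrt (srwKM2 d n (2 * l₂) x) :=
        srwT_le_sqrt_srwK_mul_srwKM2 hd l₁ l₂ x
    _ = Real.sqrt (srwK d n (2 * l₁) x * srwKM2 d n (2 * l₂) x) := (Real.sqrt_mul hK _).symm
    _ ≤ Real.sqrt (a * b) := Real.sqrt_le_sqrt (mul_le_mul ha hb hM (hK.trans ha))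

/-- The `l = 0` instance: `T_{n,0}(x) ≤ √K_{n,0}(x) · √KM₂_{n,0}(x)`.
[cite: FitznerVanDerHofstad2016NoBLE, §5.2 (5.9) p. 1091] -/
theorem srwT_zero_le_sqrt_srwK_mul_srwKM2 {n : ℕ} (hd : 2 * n + 1 ≤ d) (x : Fin d → ℤ) :
    srwT d n 0 x ≤ Real.sqrt (srwK d n 0 x) * Real.sqrt (srwKM2 d n 0 x) := by
  simpa using srwT_le_sqrt_srwK_mul_srwKM2 hd 0 0 x

/-- The `l = 1` instance: `T_{n,1}(x) ≤ min(√K_{n,0}(x) · √KM₂_{n,2}(x), √K_{n,2}(x) · √KM₂_{n,0}(x))`.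
[cite: FitznerVanDerHofstad2016NoBLE, §5.2 (5.9), (5.11) p. 1091–1092] -/
theorem srwT_one_le_min {n : ℕ} (hd : 2 * n + 1 ≤ d) (x : Fin d → ℤ) :
    srwT d n 1 x ≤ min (Real.sqrt (srwK d n 0 x) * Real.sqrt (srwKM2 d n 2 x))
      (Real.sqrt (srwK d n 2 x) * Real.sqrt (srwKM2 d n 0 x)) := by
  refine le_min ?_ ?_
  · simpa using srwT_le_sqrt_srwK_mul_srwKM2 hd 0 1 x
  · simpa using srwT_le_sqrt_srwK_mul_srwKM2 hd 1 0 x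

/-- The `l = 2` balanced instance: `T_{n,2}(x) ≤ √K_{n,2}(x) · √KM₂_{n,2}(x)`.
[cite: FitznerVanDerHofstad2016NoBLE, §5.2 (5.9) p. 1091] -/
theorem srwT_two_le_sqrt_srwK_mul_srwKM2 {n : ℕ} (hd : 2 * n + 1 ≤ d) (x : Fin d → ℤ) :
    srwT d n 2 x ≤ Real.sqrt (srwK d n 2 x) * Real.sqrt (srwKM2 d n 2 x) := by
  simpa using srwT_le_sqrt_srwK_mul_srwKM2 hd 1 1 x

end Literature.Probability.FitznerVanDerHofstad2017
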